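import Literature.Claims.NS.Otelbaev2013
import HarnessLib

/-!
# Barrier `AbstractAPrioriEstimateDirectSum` — the 2-block construction, part 1 (the instance, (У.1)–(У.4))

Sibling construction file (part 1 of 2; part 2 = `AbstractAPrioriEstimateDirectSumProofs.lean` with (У.5),
the witness and the discharge) of the catalogue entry
`Literature.Barriers.NavierStokesRegularity.AbstractAPrioriEstimateDirectSum` (pattern of
`TaoAveragedBlowupProofs.lean`: the entry file stays light; this file carries the construction).
Everything PROVED. The construction is the ONE-BLOCK truncation of «sup»'s 2014 `ℓ₂` countermodel to
Otelbaev's Theorem 6.1 [cite: DxdyTopic80156, post 817605 (2014-01-21)]: in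
`Ĥ = ℝ⁵³ = EuclideanSpace ℝ (Fin 53)` with the standard basis, eigenvalues `λ_i = 1` (`i < 50`),
`λ₅₀ = 50`, `λ₅₁ = 2n`, `λ₅₂ = 2n + 1`, bilinear map `L(u,v) = (u₅₁ v₅₂ / n)(e₅₁ + e₅₂)`, witness
`ů = −n(e₅₁ + e₅₂)` with `A^{-1}ů = −½e₅₁ − (n/(2n+1))e₅₂`. For `n ≥ 26` the data satisfy the cell's typing
`Otelbaev2013.Setting.Y1 (−1/2) 4`, `Y2`, `Y3`, `Y4`, `Y5 n' C_P` (all `n' ≥ 0`, `C_P > 0`, since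
`L_P ≡ 0`), `WeakEstimate (−1) 1 ů`, `ů + L(ů,ů) = 0`, `‖ů‖ = n√2`. Independent kernel construction by
the salvage seat (cell ns-claims, D-0090); the cell's verdict theorem for C01 is refuter-1's Summits-side
`…Theorems.Otelbaev2013.not_Theorem61`, built from the same published family.

* this file: `S53 n` (the instance), coordinate toolkit, `S53_y1`, `S53_y2`, `S53_y3`, `S53_y4`;
* part 2: `S53_y5`, `uWit`/`wWit`, `violation`, `abstractAPrioriEstimateDirectSum_holds`,
  `not_otelbaev2013_theorem61`, `not_otelbaev2013_theorem62`.

WHAT THIS IS NOT: not a claim about NS regularity or blow-up; not a claim about any author beyond the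
typed locator.
-/

noncomputable section
open scoped RealInnerProductSpace
open Literature.Claims.NS.Otelbaev2013 Set Function

namespace Literature.Barriers.NavierStokesRegularity

namespace AbstractAPrioriEstimateDirectSum


/-- `ℝ⁵³` (plumbing abbreviation). [folklore] -/
abbrev H53 : Type := EuclideanSpace ℝ (Fin 53)

/-- Eigenvalues of the block: `1` on indices `< 50` (the inert ground space `G₁`, `dim = 50 ≥ 20`),
`50` at index `50` (so `λ₂ = 50 ∈ [16, 100]`), `2n`, `2n+1` at indices `51`, `52` (the active block).
[folklore] -/
def eig53 (n : ℕ) (i : Fin 53) : ℝ :=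
  if i.val < 50 then 1 else if i.val = 50 then 50 else if i.val = 51 then 2 * n else 2 * n + 1

/-- Basis vector `e₅₁`. [folklore] -/
def e51 : H53 := EuclideanSpace.single (51 : Fin 53) (1 : ℝ)

/-- Basis vector `e₅₂`. [folklore] -/
def e52 : H53 := EuclideanSpace.single (52 : Fin 53) (1 : ℝ)

/-- The bilinear block `L(u,v) = (u₅₁ v₅₂ / n) • (e₅₁ + e₅₂)` (sup's `L(e_{2n}, e_{2n+1}) = (e_{2n}+e_{2n+1})/n`,
zero on all other basis pairs). [folklore] -/
def Lblock (n : ℕ) : H53 →ₗ[ℝ] H53 →ₗ[ℝ] H53 :=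
  LinearMap.mk₂ ℝ (fun u v => (u 51 * v 52 / (n : ℝ)) • (e51 + e52))
    (fun u u' v => by simp only [PiLp.add_apply]; rw [← add_smul]; congr 1; ring)
    (fun c u v => by simp only [PiLp.smul_apply, smul_eq_mul]; rw [smul_smul]; congr 1; ring)
    (fun u v v' => by simp only [PiLp.add_apply]; rw [← add_smul]; congr 1; ring)
    (fun c u v => by simp only [PiLp.smul_apply, smul_eq_mul]; rw [smul_smul]; congr 1; ring)

/-- The instance `(ℝ⁵³, A, L)` as an `Otelbaev2013.Setting` (standard basis as a `HilbertBasis`).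
[folklore] -/
def S53 (n : ℕ) : Setting (Fin 53) H53 where
  basis := (EuclideanSpace.basisFun (Fin 53) ℝ).toHilbertBasis
  eig := eig53 n
  L := Lblock n

variable (n : ℕ)

/-- Block computation `basis_inner` for sup's 2014 family (one-block truncation in `ℝ⁵³`). [cite: DxdyTopic80156, post 817605 (2014-01-21)] -/
@[simp] theorem basis_inner (i : Fin 53) (u : H53) : ⟪(S53 n).basis i, u⟫ = u i := by
  simp [S53, EuclideanSpace.basisFun_apply, EuclideanSpace.inner_single_left]

/-- Block computation `eig_def` for sup's 2014 family (one-block truncation in `ℝ⁵³`). [cite: DxdyTopic80156, post 817605 (2014-01-21)] -/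
theorem eig_def (i : Fin 53) : (S53 n).eig i = eig53 n i := rfl

/-- Block computation `L_apply` for sup's 2014 family (one-block truncation in `ℝ⁵³`). [cite: DxdyTopic80156, post 817605 (2014-01-21)] -/
theorem L_apply (u v : H53) : (S53 n).L u v = (u 51 * v 52 / (n : ℝ)) • (e51 + e52) := rfl

/-- Block computation `e51_apply` for sup's 2014 family (one-block truncation in `ℝ⁵³`). [cite: DxdyTopic80156, post 817605 (2014-01-21)] -/
@[simp] theorem e51_apply (i : Fin 53) : e51 i = if i = 51 then 1 else 0 := by
  simp [e51]

/-- Block computation `e52_apply` for sup's 2014 family (one-block truncation in `ℝ⁵³`). [cite: DxdyTopic80156, post 817605 (2014-01-21)] -/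
@[simp] theorem e52_apply (i : Fin 53) : e52 i = if i = 52 then 1 else 0 := by
  simp [e52]

/-- Block computation `L_apply_coord` for sup's 2014 family (one-block truncation in `ℝ⁵³`). [cite: DxdyTopic80156, post 817605 (2014-01-21)] -/
theorem L_apply_coord (u v : H53) (i : Fin 53) :
    ((S53 n).L u v) i = (u 51 * v 52 / (n : ℝ)) * ((if i = 51 then 1 else 0) + (if i = 52 then 1 else 0)) := by
  rw [L_apply]; simp only [PiLp.smul_apply, PiLp.add_apply, e51_apply, e52_apply, smul_eq_mul]

/-- Block computation `L_apply_51` for sup's 2014 family (one-block truncation in `ℝ⁵³`). [cite: DxdyTopic80156, post 817605 (2014-01-21)] -/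
theorem L_apply_51 (u v : H53) : ((S53 n).L u v) 51 = u 51 * v 52 / (n : ℝ) := by
  rw [L_apply_coord]
  simp [show ((51 : Fin 53) = 52) = False by decide]

/-- Block computation `L_apply_52` for sup's 2014 family (one-block truncation in `ℝ⁵³`). [cite: DxdyTopic80156, post 817605 (2014-01-21)] -/
theorem L_apply_52 (u v : H53) : ((S53 n).L u v) 52 = u 51 * v 52 / (n : ℝ) := by
  rw [L_apply_coord]
  simp [show ((52 : Fin 53) = 51) = False by decide]

/-- Block computation `L_apply_other` for sup's 2014 family (one-block truncation in `ℝ⁵³`). [cite: DxdyTopic80156, post 817605 (2014-01-21)] -/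
theorem L_apply_other (u v : H53) {i : Fin 53} (h51 : i ≠ 51) (h52 : i ≠ 52) : ((S53 n).L u v) i = 0 := by
  rw [L_apply_coord]; simp [h51, h52]

/-- Block computation `eig_lt50` for sup's 2014 family (one-block truncation in `ℝ⁵³`). [cite: DxdyTopic80156, post 817605 (2014-01-21)] -/
theorem eig_lt50 {i : Fin 53} (hi : i.val < 50) : eig53 n i = 1 := by simp [eig53, hi]
/-- Block computation `eig_50` for sup's 2014 family (one-block truncation in `ℝ⁵³`). [cite: DxdyTopic80156, post 817605 (2014-01-21)] -/
theorem eig_50 : eig53 n 50 = 50 := by simp [eig53]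
/-- Block computation `eig_51` for sup's 2014 family (one-block truncation in `ℝ⁵³`). [cite: DxdyTopic80156, post 817605 (2014-01-21)] -/
theorem eig_51 : eig53 n 51 = 2 * n := by simp [eig53]
/-- Block computation `eig_52` for sup's 2014 family (one-block truncation in `ℝ⁵³`). [cite: DxdyTopic80156, post 817605 (2014-01-21)] -/
theorem eig_52 : eig53 n 52 = 2 * n + 1 := by simp [eig53]

/-- Block computation `one_le_eig` for sup's 2014 family (one-block truncation in `ℝ⁵³`). [cite: DxdyTopic80156, post 817605 (2014-01-21)] -/
theorem one_le_eig (hn : 1 ≤ n) (i : Fin 53) : 1 ≤ eig53 n i := by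
  unfold eig53
  have hn' : (1 : ℝ) ≤ n := by exact_mod_cast hn
  split_ifs <;> linarith

/-- Block computation `eig_eq_one_iff` for sup's 2014 family (one-block truncation in `ℝ⁵³`). [cite: DxdyTopic80156, post 817605 (2014-01-21)] -/
theorem eig_eq_one_iff (hn : 1 ≤ n) (i : Fin 53) : eig53 n i = 1 ↔ i.val < 50 := by
  constructor
  · intro h
    by_contra hi
    unfold eig53 at h
    have hn' : (1 : ℝ) ≤ n := by exact_mod_cast hn
    split_ifs at h with h1 h2 <;> first | exact hi ‹_› | linarith
  · exact eig_lt50 n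

/-- Block computation `S53_y3` for sup's 2014 family (one-block truncation in `ℝ⁵³`). [cite: DxdyTopic80156, post 817605 (2014-01-21)] -/
theorem S53_y3 (hn : 26 ≤ n) : (S53 n).Y3 := by
  have hn1 : 1 ≤ n := le_trans (by norm_num) hn
  have hnr : (26 : ℝ) ≤ n := by exact_mod_cast hn
  refine ⟨⟨0, eig_lt50 n (i := 0) (by decide)⟩, one_le_eig n hn1,
    ⟨50, by norm_num, by norm_num, ⟨50, eig_50 n⟩, ?_⟩, ?_, ?_⟩
  · intro i
    show eig53 n i = 1 ∨ 50 ≤ eig53 n i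
    unfold eig53
    split_ifs <;> first | exact Or.inl rfl | (right; linarith)
  · refine ⟨fun k => ⟨k.val, by omega⟩, fun a b hab => ?_, fun k => eig_lt50 n (by simp; omega)⟩
    ext; simpa using congrArg Fin.val hab
  · intro R
    exact (Set.finite_range _).inter_of_left _


/-! ### coordinate toolkit -/

/-- Block computation `abs_apply_le_norm` for sup's 2014 family (one-block truncation in `ℝ⁵³`). [cite: DxdyTopic80156, post 817605 (2014-01-21)] -/
theorem abs_apply_le_norm (x : H53) (i : Fin 53) : |x i| ≤ ‖x‖ := by
  have h1 : (x i) ^ 2 ≤ ‖x‖ ^ 2 := by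
    rw [EuclideanSpace.real_norm_sq_eq]
    exact Finset.single_le_sum (f := fun j => (x j) ^ 2) (fun j _ => sq_nonneg _) (Finset.mem_univ i)
  calc |x i| = Real.sqrt ((x i) ^ 2) := (Real.sqrt_sq_eq_abs _).symm
    _ ≤ Real.sqrt (‖x‖ ^ 2) := Real.sqrt_le_sqrt h1
    _ = ‖x‖ := Real.sqrt_sq (norm_nonneg _)

/-- Block computation `norm_e51_add_e52` for sup's 2014 family (one-block truncation in `ℝ⁵³`). [cite: DxdyTopic80156, post 817605 (2014-01-21)] -/
theorem norm_e51_add_e52 : ‖e51 + e52‖ = Real.sqrt 2 := by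
  rw [EuclideanSpace.norm_eq]
  congr 1
  simp only [PiLp.add_apply, e51_apply, e52_apply, Real.norm_eq_abs, sq_abs]
  rw [Finset.sum_eq_add_of_mem (51 : Fin 53) (52 : Fin 53) (Finset.mem_univ _) (Finset.mem_univ _)
    (by decide)]
  · norm_num [show ((51 : Fin 53) = 52) = False by decide, show ((52 : Fin 53) = 51) = False by decide]
  · intro c _ hc
    simp [hc.1, hc.2]

/-- Block computation `isPow_iff` for sup's 2014 family (one-block truncation in `ℝ⁵³`). [cite: DxdyTopic80156, post 817605 (2014-01-21)] -/
theorem isPow_iff (s : ℝ) (u w : H53) :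
    (S53 n).IsPow s u w ↔ ∀ i, w i = eig53 n i ^ s * u i := by
  simp [Setting.IsPow, eig_def]

/-- Block computation `norm_L` for sup's 2014 family (one-block truncation in `ℝ⁵³`). [cite: DxdyTopic80156, post 817605 (2014-01-21)] -/
theorem norm_L (u v : H53) :
    ‖(S53 n).L u v‖ = |u 51 * v 52| / n * Real.sqrt 2 := by
  rw [L_apply, norm_smul, norm_e51_add_e52, Real.norm_eq_abs, abs_div, Nat.abs_cast]

/-! ### (У.1) -/

/-- Block computation `S53_y1` for sup's 2014 family (one-block truncation in `ℝ⁵³`). [cite: DxdyTopic80156, post 817605 (2014-01-21)] -/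
theorem S53_y1 (hn : 1 ≤ n) : (S53 n).Y1 (-1 / 2) 4 := by
  refine ⟨fun i => one_le_eig n hn i, ?_⟩
  intro u v wu wv hu hv
  rw [isPow_iff] at hu hv
  have hnpos : (0 : ℝ) < n := by exact_mod_cast hn
  have h2n : (0 : ℝ) < 2 * n := by positivity
  have h2n1 : (0 : ℝ) < 2 * n + 1 := by positivity
  -- recover |u 51| and |v 52| from the weighted coordinates
  have hu51 : |u 51| = Real.sqrt (2 * n) * |wu 51| := by
    have h := hu 51
    rw [eig_51] at h
    have hpow : (2 * (n : ℝ)) ^ (-1 / 2 : ℝ) = (Real.sqrt (2 * n))⁻¹ := by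
      rw [show (-1 / 2 : ℝ) = -(1 / 2) by norm_num, Real.rpow_neg h2n.le, ← Real.sqrt_eq_rpow]
    rw [hpow] at h
    have hs : 0 < Real.sqrt (2 * n) := Real.sqrt_pos.2 h2n
    have : u 51 = Real.sqrt (2 * n) * wu 51 := by
      rw [h]; field_simp
    rw [this, abs_mul, abs_of_pos hs]
  have hv52 : |v 52| = Real.sqrt (2 * n + 1) * |wv 52| := by
    have h := hv 52
    rw [eig_52] at h
    have hpow : (2 * (n : ℝ) + 1) ^ (-1 / 2 : ℝ) = (Real.sqrt (2 * n + 1))⁻¹ := by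
      rw [show (-1 / 2 : ℝ) = -(1 / 2) by norm_num, Real.rpow_neg h2n1.le, ← Real.sqrt_eq_rpow]
    rw [hpow] at h
    have hs : 0 < Real.sqrt (2 * n + 1) := Real.sqrt_pos.2 h2n1
    have : v 52 = Real.sqrt (2 * n + 1) * wv 52 := by
      rw [h]; field_simp
    rw [this, abs_mul, abs_of_pos hs]
  rw [norm_L, abs_mul, hu51, hv52]
  have ha : |wu 51| ≤ ‖wu‖ := abs_apply_le_norm _ _
  have hb : |wv 52| ≤ ‖wv‖ := abs_apply_le_norm _ _
  have hs2 : Real.sqrt 2 ≤ 2 := by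
    rw [show (2 : ℝ) = Real.sqrt 4 by rw [show (4:ℝ) = 2^2 by norm_num, Real.sqrt_sq (by norm_num)]]
    exact Real.sqrt_le_sqrt (by norm_num)
  have hsa : Real.sqrt (2 * n) ≤ Real.sqrt (2 * n + 1) := Real.sqrt_le_sqrt (by linarith)
  have hsb : Real.sqrt (2 * n + 1) * Real.sqrt (2 * n + 1) = 2 * n + 1 := Real.mul_self_sqrt h2n1.le
  -- |.| product ≤ (2n+1) ‖wu‖ ‖wv‖, and (2n+1)/n * √2 ≤ 4 for n ≥ 1? No: use √(2n)√(2n+1) ≤ 2n+1 ≤ ... ;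
  -- we need (√(2n)√(2n+1)/n)·√2 ≤ 4, i.e. 2·2n(2n+1) ≤ 16 n², i.e. 2n+1 ≤ 4n.
  have key : Real.sqrt (2 * n) * Real.sqrt (2 * n + 1) / n * Real.sqrt 2 ≤ 4 := by
    have hn1 : (1 : ℝ) ≤ n := by exact_mod_cast hn
    rw [div_mul_eq_mul_div, div_le_iff₀ hnpos]
    have hprod : Real.sqrt (2 * n) * Real.sqrt (2 * n + 1) * Real.sqrt 2 =
        Real.sqrt (2 * n * (2 * n + 1) * 2) := by
      rw [← Real.sqrt_mul h2n.le, ← Real.sqrt_mul (by positivity)]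
    rw [hprod]
    calc Real.sqrt (2 * n * (2 * n + 1) * 2) ≤ Real.sqrt ((4 * n) ^ 2) :=
          Real.sqrt_le_sqrt (by nlinarith)
      _ = 4 * n := Real.sqrt_sq (by positivity)
  have hwu : 0 ≤ ‖wu‖ := norm_nonneg _
  have hwv : 0 ≤ ‖wv‖ := norm_nonneg _
  calc Real.sqrt (2 * ↑n) * |wu 51| * (Real.sqrt (2 * ↑n + 1) * |wv 52|) / ↑n * Real.sqrt 2
      = (Real.sqrt (2 * n) * Real.sqrt (2 * n + 1) / n * Real.sqrt 2) * (|wu 51| * |wv 52|) := by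
        field_simp
    _ ≤ 4 * (‖wu‖ * ‖wv‖) := by
        refine mul_le_mul key (mul_le_mul ha hb (abs_nonneg _) hwu) (by positivity) (by norm_num)
    _ = 4 * ‖wu‖ * ‖wv‖ := by ring

/-! ### (У.2) -/

/-- Block computation `inner_e51_add_e52` for sup's 2014 family (one-block truncation in `ℝ⁵³`). [cite: DxdyTopic80156, post 817605 (2014-01-21)] -/
theorem inner_e51_add_e52 (u : H53) : ⟪u, e51 + e52⟫ = u 51 + u 52 := by
  rw [inner_add_right, e51, e52, EuclideanSpace.inner_single_right, EuclideanSpace.inner_single_right]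
  simp

/-- Block computation `S53_y2` for sup's 2014 family (one-block truncation in `ℝ⁵³`). [cite: DxdyTopic80156, post 817605 (2014-01-21)] -/
theorem S53_y2 : (S53 n).Y2 := by
  intro u hu
  obtain ⟨lam, hlam⟩ := hu
  simp only [basis_inner, eig_def] at hlam
  rw [L_apply, inner_smul_right, inner_e51_add_e52]
  -- if both coordinates are nonzero the eigenvalues 2n and 2n+1 coincide
  by_cases h51 : u 51 = 0
  · simp [h51]
  by_cases h52 : u 52 = 0
  · simp [h52]
  exfalso
  have h1 := hlam 51 h51
  have h2 := hlam 52 h52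
  rw [eig_51] at h1
  rw [eig_52] at h2
  linarith

/-! ### (У.4) -/

/-- Block computation `G1_coord` for sup's 2014 family (one-block truncation in `ℝ⁵³`). [cite: DxdyTopic80156, post 817605 (2014-01-21)] -/
theorem G1_coord (hn : 1 ≤ n) {e : H53} (he : e ∈ (S53 n).G1) : e 51 = 0 ∧ e 52 = 0 := by
  simp only [Setting.G1, Set.mem_setOf_eq, basis_inner, eig_def] at he
  have hn' : (1 : ℝ) ≤ n := by exact_mod_cast hn
  constructor
  · by_contra h
    have := he 51 h
    rw [eig_51] at this
    linarith
  · by_contra h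
    have := he 52 h
    rw [eig_52] at this
    linarith

/-- Block computation `L_eq_zero_of_left` for sup's 2014 family (one-block truncation in `ℝ⁵³`). [cite: DxdyTopic80156, post 817605 (2014-01-21)] -/
theorem L_eq_zero_of_left {u : H53} (hu : u 51 = 0) (v : H53) : (S53 n).L u v = 0 := by
  rw [L_apply, hu]; simp

/-- Block computation `L_eq_zero_of_right` for sup's 2014 family (one-block truncation in `ℝ⁵³`). [cite: DxdyTopic80156, post 817605 (2014-01-21)] -/
theorem L_eq_zero_of_right (u : H53) {v : H53} (hv : v 52 = 0) : (S53 n).L u v = 0 := by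
  rw [L_apply, hv]; simp

/-- Block computation `inner_L_eq_zero` for sup's 2014 family (one-block truncation in `ℝ⁵³`). [cite: DxdyTopic80156, post 817605 (2014-01-21)] -/
theorem inner_L_eq_zero (u v : H53) {e : H53} (h51 : e 51 = 0) (h52 : e 52 = 0) :
    ⟪(S53 n).L u v, e⟫ = 0 := by
  rw [L_apply, inner_smul_left, real_inner_comm, inner_e51_add_e52, h51, h52]; simp

/-- Block computation `S53_y4` for sup's 2014 family (one-block truncation in `ℝ⁵³`). [cite: DxdyTopic80156, post 817605 (2014-01-21)] -/
theorem S53_y4 (hn : 1 ≤ n) : (S53 n).Y4 := by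
  intro e he u
  obtain ⟨h51, h52⟩ := G1_coord n hn he
  have hLeu : (S53 n).L e u = 0 := L_eq_zero_of_left n h51 u
  have hLue : (S53 n).L u e = 0 := L_eq_zero_of_right n u h52
  refine ⟨hLeu, hLue, ?_, ?_, ?_, ?_⟩
  · simp [Setting.Lsym, hLeu, hLue]
  · intro g
    simp only [Setting.Lsym, inner_add_left, inner_L_eq_zero n _ _ h51 h52, add_zero]
  · simp [Setting.Lsym, hLeu, hLue]
  · intro g
    have h1 : (S53 n).L e g = 0 := L_eq_zero_of_left n h51 g
    have h2 : (S53 n).L g e = 0 := L_eq_zero_of_right n g h52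
    simp [Setting.Lsym, h1, h2]


end AbstractAPrioriEstimateDirectSum

end Literature.Barriers.NavierStokesRegularity

end
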